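import Literature.NumberTheory.EllipticCurves.ModularCurveKleinJ
import Literature.NumberTheory.EllipticCurves.EichlerIntegralWeierstrassProofs
import HarnessLib

/-!
# Level-one modular forms with prescribed zeros: `Δ^a ∏ₛ (E₄³Δ(s) − E₄(s)³Δ)^{nₛ}`

Topic `NumberTheory/EllipticCurves`; a proofs-only file (theorems only, no definitions, no named
facts). For a finite set `S ⊆ ℍ`, exponents `n : ℍ → ℕ` and `a : ℕ` consider the function
`G(τ) = Δ(τ)^a ∏_{s ∈ S} (E₄(τ)³Δ(s) − E₄(s)³Δ(τ))^{n(s)}` on `ℍ` (Mathlib's level-one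
Eisenstein series `E₄` and modular discriminant `Δ`). Each factor `H_s = E₄³Δ(s) − E₄(s)³Δ`
is a level-one modular form of weight `12` vanishing at `s` (it is `Δ(s)Δ·(j − j(s))`,
`j = E₄³/Δ`) and tending to `Δ(s) ≠ 0` at `i∞`. Hence (this file):

* `levelOneAnnihilator_apply_smul`, `levelOneAnnihilator_slash` — `G` is a level-one modular
  form of weight `k = 12(a + ∑ n(s))`: `G(γτ) = (cτ + d)^k G(τ)` for all `γ ∈ SL(2, ℤ)`;
* `analyticOnNhd_levelOneAnnihilator`, `mdifferentiable_levelOneAnnihilator` — `G` is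
  holomorphic;
* `natCast_le_analyticOrderAt_levelOneAnnihilator` — `G` vanishes to order `≥ n(s)` at every
  point `γs`, `γ ∈ SL(2, ℤ)`, `s ∈ S`;
* `tendsto_levelOneAnnihilator_prod_atImInfty`, `isZeroAtImInfty_levelOneAnnihilator`,
  `exists_levelOneAnnihilator_ne_zero` — at `i∞` the product of the `H_s^{n(s)}` tends to
  `∏ Δ(s)^{n(s)} ≠ 0`, so `G → 0` (for `a ≥ 1`) and `G ≢ 0`.

This is the classical device of a holomorphic modular form killing the poles of a meromorphic
function on the modular curve, used to present a meromorphic function on `X₀(N)` as a quotient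
of two holomorphic forms (Shimura 1971, §2.4–2.6; Diamond–Shurman 2005, §3.2 and the proof
of Prop. 3.2.6 / §11.1 for `j`). No new definitions are made; `G` is written out in each
statement.

## References

* G. Shimura, *Introduction to the arithmetic theory of automorphic functions*, 1971: §2.4–2.6.
  [ShimuraIATAF1971]
* F. Diamond, J. Shurman, *A First Course in Modular Forms*, GTM 228, 2005: §3.2.
  [DiamondShurman2005]
* J.-P. Serre, *A Course in Arithmetic*, 1973: VII §3.3. [Serre1973]
-/

noncomputable section

open Complex Filter Topology Set Function
open UpperHalfPlane hiding I
open scoped Real Topology Manifold MatrixGroups ModularForm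

open ModularForm EisensteinSeries SlashInvariantForm ModularFormClass

namespace Literature.NumberTheory.EllipticCurves.ModularForms

variable (S : Finset ℍ) (n : ℍ → ℕ) (a : ℕ)

/-! ### Transformation law -/

/-- The factor `H_s = E₄³Δ(s) − E₄(s)³Δ` vanishes at `s`. [folklore] -/
theorem levelOneFactor_apply_self (s : ℍ) :
    E₄ s ^ 3 * ModularForm.discriminant s - E₄ s ^ 3 * ModularForm.discriminant s = 0 :=
  sub_self _

/-- `H_s(γτ) = (cτ + d)¹² H_s(τ)`: the factor `H_s` is a level-one form of weight `12`.
[folklore] -/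
theorem levelOneFactor_apply_smul (s : ℍ) (γ : SL(2, ℤ)) (τ : ℍ) :
    E₄ (γ • τ) ^ 3 * ModularForm.discriminant s - E₄ s ^ 3 * ModularForm.discriminant (γ • τ) =
      denom γ τ ^ 12 *
        (E₄ τ ^ 3 * ModularForm.discriminant s - E₄ s ^ 3 * ModularForm.discriminant τ) := by
  rw [levelOne_apply_smul E₄ γ τ, discriminant_apply_smul γ τ, zpow_ofNat, zpow_ofNat]
  ring

/-- **Transformation law of `G`**: `G(γτ) = (cτ + d)^{12(a + ∑ n(s))} G(τ)` for
`γ ∈ SL(2, ℤ)` (`E₄`, `Δ` are level-one forms of weights `4`, `12`). [folklore] -/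
theorem levelOneAnnihilator_apply_smul (γ : SL(2, ℤ)) (τ : ℍ) :
    ModularForm.discriminant (γ • τ) ^ a * ∏ s ∈ S, (E₄ (γ • τ) ^ 3 * ModularForm.discriminant s -
        E₄ s ^ 3 * ModularForm.discriminant (γ • τ)) ^ n s =
      denom γ τ ^ (12 * (a + ∑ s ∈ S, n s)) *
        (ModularForm.discriminant τ ^ a * ∏ s ∈ S, (E₄ τ ^ 3 * ModularForm.discriminant s -
          E₄ s ^ 3 * ModularForm.discriminant τ) ^ n s) := by
  have key : ∀ s ∈ S, (E₄ (γ • τ) ^ 3 * ModularForm.discriminant s -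
      E₄ s ^ 3 * ModularForm.discriminant (γ • τ)) ^ n s =
      (denom γ τ ^ 12) ^ n s *
        (E₄ τ ^ 3 * ModularForm.discriminant s - E₄ s ^ 3 * ModularForm.discriminant τ) ^ n s := by
    intro s _
    rw [← mul_pow, levelOneFactor_apply_smul]
  rw [Finset.prod_congr rfl key, Finset.prod_mul_distrib, Finset.prod_pow_eq_pow_sum,
    discriminant_apply_smul γ τ, zpow_ofNat, mul_pow, ← pow_mul, ← pow_mul]
  ring

/-- **`G` is invariant under the weight-`k` action of `SL(2, ℤ)`**, `k = 12(a + ∑ n(s))`.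
[folklore] -/
theorem levelOneAnnihilator_slash (γ : SL(2, ℤ)) :
    ((fun τ : ℍ ↦ ModularForm.discriminant τ ^ a * ∏ s ∈ S, (E₄ τ ^ 3 * ModularForm.discriminant s -
        E₄ s ^ 3 * ModularForm.discriminant τ) ^ n s) ∣[((12 * (a + ∑ s ∈ S, n s) : ℕ) : ℤ)] γ) =
      fun τ : ℍ ↦ ModularForm.discriminant τ ^ a * ∏ s ∈ S, (E₄ τ ^ 3 * ModularForm.discriminant s -
        E₄ s ^ 3 * ModularForm.discriminant τ) ^ n s := by
  funext τ
  rw [ModularForm.SL_slash_apply, levelOneAnnihilator_apply_smul, zpow_neg, zpow_natCast,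
    mul_comm (denom γ τ ^ _) _, mul_assoc, mul_inv_cancel₀ (pow_ne_zero _ (denom_ne_zero γ τ)),
    mul_one]

/-! ### Holomorphy -/

/-- `E₄ ∘ ofComplex` is analytic on the upper half-plane. [folklore] -/
theorem analyticOnNhd_E₄_comp_ofComplex : AnalyticOnNhd ℂ (⇑E₄ ∘ ofComplex) {z : ℂ | 0 < z.im} :=
  (UpperHalfPlane.mdifferentiable_iff.mp E₄.holo').analyticOnNhd isOpen_upperHalfPlaneSet

/-- `Δ ∘ ofComplex` is analytic on the upper half-plane. [folklore] -/
theorem analyticOnNhd_discriminant_comp_ofComplex :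
    AnalyticOnNhd ℂ (ModularForm.discriminant ∘ ofComplex) {z : ℂ | 0 < z.im} :=
  (UpperHalfPlane.mdifferentiable_iff.mp CuspForm.discriminant.holo').analyticOnNhd
    isOpen_upperHalfPlaneSet

/-- The factor `H_s ∘ ofComplex` is analytic at every point of the upper half-plane. [folklore] -/
theorem analyticAt_levelOneFactor (s : ℍ) {z : ℂ} (hz : 0 < z.im) :
    AnalyticAt ℂ (fun w : ℂ ↦ E₄ (ofComplex w) ^ 3 * ModularForm.discriminant s -
      E₄ s ^ 3 * ModularForm.discriminant (ofComplex w)) z :=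
  (((analyticOnNhd_E₄_comp_ofComplex z hz).pow 3).mul analyticAt_const).sub
    (analyticAt_const.mul (analyticOnNhd_discriminant_comp_ofComplex z hz))

/-- **`G ∘ ofComplex` is analytic on the upper half-plane.** [folklore] -/
theorem analyticAt_levelOneAnnihilator {z : ℂ} (hz : 0 < z.im) :
    AnalyticAt ℂ ((fun τ : ℍ ↦ ModularForm.discriminant τ ^ a *
      ∏ s ∈ S, (E₄ τ ^ 3 * ModularForm.discriminant s -
        E₄ s ^ 3 * ModularForm.discriminant τ) ^ n s) ∘ ofComplex) z := by
  show AnalyticAt ℂ (fun w : ℂ ↦ ModularForm.discriminant (ofComplex w) ^ a *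
      ∏ s ∈ S, (E₄ (ofComplex w) ^ 3 * ModularForm.discriminant s -
        E₄ s ^ 3 * ModularForm.discriminant (ofComplex w)) ^ n s) z
  exact ((analyticOnNhd_discriminant_comp_ofComplex z hz).pow a).mul
    (Finset.analyticAt_fun_prod S fun s _ ↦ (analyticAt_levelOneFactor s hz).pow (n s))

/-- `G ∘ ofComplex` is analytic on `{im > 0}`. [folklore] -/
theorem analyticOnNhd_levelOneAnnihilator :
    AnalyticOnNhd ℂ ((fun τ : ℍ ↦ ModularForm.discriminant τ ^ a *
      ∏ s ∈ S, (E₄ τ ^ 3 * ModularForm.discriminant s -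
        E₄ s ^ 3 * ModularForm.discriminant τ) ^ n s) ∘ ofComplex) {z : ℂ | 0 < z.im} :=
  fun _ hz ↦ analyticAt_levelOneAnnihilator S n a hz

/-- **`G` is holomorphic on `ℍ`.** [folklore] -/
theorem mdifferentiable_levelOneAnnihilator :
    MDifferentiable 𝓘(ℂ) 𝓘(ℂ) (fun τ : ℍ ↦ ModularForm.discriminant τ ^ a *
      ∏ s ∈ S, (E₄ τ ^ 3 * ModularForm.discriminant s -
        E₄ s ^ 3 * ModularForm.discriminant τ) ^ n s) :=
  UpperHalfPlane.mdifferentiable_iff.mpr (analyticOnNhd_levelOneAnnihilator S n a).differentiableOn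

/-! ### Orders of vanishing -/

/-- **`G` vanishes to order at least `n(s)` at `γs`** (`s ∈ S`, `γ ∈ SL(2, ℤ)`): the factor
`H_s^{n(s)}` does, since `H_s(γs) = (cs + d)¹²H_s(s) = 0`. [folklore] -/
theorem natCast_le_analyticOrderAt_levelOneAnnihilator {s : ℍ} (hs : s ∈ S) (γ : SL(2, ℤ)) :
    (n s : ℕ∞) ≤ analyticOrderAt ((fun τ : ℍ ↦ ModularForm.discriminant τ ^ a *
      ∏ t ∈ S, (E₄ τ ^ 3 * ModularForm.discriminant t -
        E₄ t ^ 3 * ModularForm.discriminant τ) ^ n t) ∘ ofComplex) ((γ • s : ℍ) : ℂ) := by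
  classical
  set z₀ : ℂ := ((γ • s : ℍ) : ℂ) with hz₀
  have hz₀im : 0 < z₀.im := (γ • s).im_pos
  -- split off the factor at `s`
  have hsplit : ((fun τ : ℍ ↦ ModularForm.discriminant τ ^ a *
      ∏ t ∈ S, (E₄ τ ^ 3 * ModularForm.discriminant t -
        E₄ t ^ 3 * ModularForm.discriminant τ) ^ n t) ∘ ofComplex) =
      (fun w : ℂ ↦ ModularForm.discriminant (ofComplex w) ^ a *
        ∏ t ∈ S.erase s, (E₄ (ofComplex w) ^ 3 * ModularForm.discriminant t -
          E₄ t ^ 3 * ModularForm.discriminant (ofComplex w)) ^ n t) *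
      fun w : ℂ ↦ (E₄ (ofComplex w) ^ 3 * ModularForm.discriminant s -
          E₄ s ^ 3 * ModularForm.discriminant (ofComplex w)) ^ n s := by
    funext w
    simp only [Pi.mul_apply, comp_apply]
    rw [mul_assoc, Finset.prod_erase_mul S (fun t ↦ (E₄ (ofComplex w) ^ 3 *
      ModularForm.discriminant t - E₄ t ^ 3 * ModularForm.discriminant (ofComplex w)) ^ n t) hs]
  have hA : AnalyticAt ℂ (fun w : ℂ ↦ ModularForm.discriminant (ofComplex w) ^ a *
      ∏ t ∈ S.erase s, (E₄ (ofComplex w) ^ 3 * ModularForm.discriminant t -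
        E₄ t ^ 3 * ModularForm.discriminant (ofComplex w)) ^ n t) z₀ :=
    ((analyticOnNhd_discriminant_comp_ofComplex z₀ hz₀im).pow a).mul
      (Finset.analyticAt_fun_prod _ fun t _ ↦ (analyticAt_levelOneFactor t hz₀im).pow (n t))
  have hH := analyticAt_levelOneFactor s hz₀im
  have hB : AnalyticAt ℂ (fun w : ℂ ↦ (E₄ (ofComplex w) ^ 3 * ModularForm.discriminant s -
      E₄ s ^ 3 * ModularForm.discriminant (ofComplex w)) ^ n s) z₀ := hH.pow (n s)
  -- the factor vanishes at `z₀`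
  have hzero : E₄ (ofComplex z₀) ^ 3 * ModularForm.discriminant s -
      E₄ s ^ 3 * ModularForm.discriminant (ofComplex z₀) = 0 := by
    rw [hz₀, ofComplex_apply, levelOneFactor_apply_smul, levelOneFactor_apply_self, mul_zero]
  have h1 : 1 ≤ analyticOrderAt (fun w : ℂ ↦ E₄ (ofComplex w) ^ 3 * ModularForm.discriminant s -
      E₄ s ^ 3 * ModularForm.discriminant (ofComplex w)) z₀ :=
    Order.one_le_iff_ne_zero.mpr (hH.analyticOrderAt_ne_zero.mpr hzero)
  rw [hsplit, analyticOrderAt_mul hA hB]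
  refine le_add_left ?_
  rw [show (fun w : ℂ ↦ (E₄ (ofComplex w) ^ 3 * ModularForm.discriminant s -
      E₄ s ^ 3 * ModularForm.discriminant (ofComplex w)) ^ n s) =
      (fun w : ℂ ↦ E₄ (ofComplex w) ^ 3 * ModularForm.discriminant s -
        E₄ s ^ 3 * ModularForm.discriminant (ofComplex w)) ^ n s from rfl, analyticOrderAt_pow hH]
  calc (n s : ℕ∞) = n s • (1 : ℕ∞) := by simp
    _ ≤ _ := nsmul_le_nsmul_right h1 _

/-! ### Behaviour at `i∞` -/

/-- At `i∞` the product of the factors tends to `∏ Δ(s)^{n(s)}` (`E₄ → 1`, `Δ → 0`).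
[folklore] -/
theorem tendsto_levelOneAnnihilator_prod_atImInfty :
    Tendsto (fun τ : ℍ ↦ ∏ s ∈ S, (E₄ τ ^ 3 * ModularForm.discriminant s -
        E₄ s ^ 3 * ModularForm.discriminant τ) ^ n s) atImInfty
      (𝓝 (∏ s ∈ S, ModularForm.discriminant s ^ n s)) := by
  have h1 : Tendsto (fun τ : ℍ ↦ E₄ τ) atImInfty (𝓝 1) :=
    ModularForm.tendsto_E_atImInfty (by norm_num) ⟨2, rfl⟩
  have h2 : Tendsto ModularForm.discriminant atImInfty (𝓝 0) := discriminant_isZeroAtImInfty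
  refine tendsto_finsetProd S fun s _ ↦ ?_
  have := (((h1.pow 3).mul_const (ModularForm.discriminant s)).sub
    (h2.const_mul (E₄ s ^ 3))).pow (n s)
  simpa using this

/-- The limit `∏ Δ(s)^{n(s)}` is nonzero (`Δ` has no zeros on `ℍ`). [folklore] -/
theorem prod_discriminant_pow_ne_zero : ∏ s ∈ S, ModularForm.discriminant s ^ n s ≠ 0 :=
  Finset.prod_ne_zero_iff.mpr fun s _ ↦ pow_ne_zero _ (ModularForm.discriminant_ne_zero s)

/-- **`G → 0` at `i∞`** for `a ≥ 1` (`Δ^a → 0` and the other factor converges). [folklore] -/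
theorem isZeroAtImInfty_levelOneAnnihilator (ha : 1 ≤ a) :
    IsZeroAtImInfty (fun τ : ℍ ↦ ModularForm.discriminant τ ^ a *
      ∏ s ∈ S, (E₄ τ ^ 3 * ModularForm.discriminant s -
        E₄ s ^ 3 * ModularForm.discriminant τ) ^ n s) := by
  have h2 : Tendsto ModularForm.discriminant atImInfty (𝓝 0) := discriminant_isZeroAtImInfty
  have h3 : Tendsto (fun τ : ℍ ↦ ModularForm.discriminant τ ^ a) atImInfty (𝓝 0) := by
    have := h2.pow a
    rwa [zero_pow (by omega)] at this
  have := h3.mul (tendsto_levelOneAnnihilator_prod_atImInfty S n)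
  rw [zero_mul] at this
  exact this

/-- **`G ≢ 0`**: `G(τ) ≠ 0` for some `τ` (high in the cusp, where the product of the factors
is close to `∏ Δ(s)^{n(s)} ≠ 0` and `Δ(τ) ≠ 0`). [folklore] -/
theorem exists_levelOneAnnihilator_ne_zero :
    ∃ τ : ℍ, ModularForm.discriminant τ ^ a *
      ∏ s ∈ S, (E₄ τ ^ 3 * ModularForm.discriminant s -
        E₄ s ^ 3 * ModularForm.discriminant τ) ^ n s ≠ 0 := by
  have hlim := tendsto_levelOneAnnihilator_prod_atImInfty S n
  have hne := prod_discriminant_pow_ne_zero S n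
  have hev : ∀ᶠ τ : ℍ in atImInfty, ∏ s ∈ S, (E₄ τ ^ 3 * ModularForm.discriminant s -
      E₄ s ^ 3 * ModularForm.discriminant τ) ^ n s ≠ 0 :=
    hlim.eventually_ne hne
  obtain ⟨τ, hτ⟩ := hev.exists
  exact ⟨τ, mul_ne_zero (pow_ne_zero _ (ModularForm.discriminant_ne_zero τ)) hτ⟩

end Literature.NumberTheory.EllipticCurves.ModularForms

end
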